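import Literature.Barriers.ValiantsHypothesis.BDGIL24IsotypicProjectionProofs
import HarnessLib

/-!
# van den Berg–Dutta–Gesmundo–Ikenmeyer–Lysikov 2024, Theorem 1.1 (4): the `T`-isotypic
# (Gelfand–Tsetlin) components of a metapolynomial — TYPED AND PROVED
# (`BergEtAl2024.gtSubspace`, `BergEtAl2024.thm_1_1_gt`, `BergEtAl2024.thm_1_1_gt_holds`)

M. van den Berg, P. Dutta, F. Gesmundo, C. Ikenmeyer, V. Lysikov, *Algebraic metacomplexity and
representation theory*, arXiv:2411.03444 (2024) [BergEtAl2024]; val-lit row vdBDGIL24-A (support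
file of the `ValiantsHypothesis` barrier corpus, V4 ↔ V3). The statement file
`BDGIL24IsotypicNaturalProofs.lean` typed Thm. 1.1 (1)–(3) and deferred item (4):

> **Theorem 1.1 (4).** "For every semistandard tableau `T` of shape `λ ⊢ dδ` the projection of `Δ`
> onto the `T`-isotypic space can be computed by a circuit of size `O(s k^{2k²} (δd)^{2k⁴})`."
> [cite: BergEtAl2024, Thm. 1.1 (4), p.4 (PDF p.5)] (`paper:arxiv-2411.03444` p0005.txt:L83–L85)

This file types it — with the vocabulary it needs — and proves it.

## The `T`-isotypic components (§1 p.4–5, §4.5)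

"Each `λ`-isotypic component decomposes even further into a direct sum of subspaces with one
summand for each semistandard tableau `T` of shape `λ`. We call the component for `T` the
`T`-isotypic component" (p0005.txt:L5–L7). By §4.5 these are the `GZ`-isotypic spaces of the
Gelfand–Tsetlin algebra `GZ(𝔤𝔩_k)` generated by the centres `Z(𝔤𝔩_ℓ)`, `ℓ ≤ k`, for the chain
`𝔤𝔩_1 ⊂ 𝔤𝔩_2 ⊂ ⋯ ⊂ 𝔤𝔩_k` of upper-left blocks ("`𝔤𝔩_{k-1}` is included in `𝔤𝔩_k` as the subalgebra
of `𝔤𝔩_k` consisting of matrices having the `k`-th row and the `k`-th column identically equal to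
`0`", p0024.txt:L2–L4), indexed by Gelfand–Tsetlin patterns `T = λ^{(1)} → λ^{(2)} → ⋯ → λ^{(k)}`
— "in bijective correspondence with semistandard Young tableaux filled with numbers from
`{1, …, k}`" when `λ^{(k)}` is a partition (p0024.txt:L66–L72: `λ^{(ℓ)}` = shape of the boxes
labelled `≤ ℓ`) — on which "`Z(𝔤𝔩_ℓ)` acts via the central character `χ_{λ^{(ℓ)}}`"
(p0023.txt:L40–L47). Since central characters separate isotypic components (Harish-Chandra,
[BDGIL24, Thm. 4.11]), the `GZ`-isotypic space of `T` is the INTERSECTION over `ℓ` of the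
`λ^{(ℓ)}`-isotypic components of the restrictions of the representation to `𝔤𝔩_ℓ`; at the group
level (rational representations of `GL`) this is what is typed here:

* `glLift h : GL (Fin ℓ) K →* GL (Fin k) K` (`h : ℓ ≤ k`) — the block embedding
  `g ↦ diag(g, 1_{k-ℓ})` (matrix `liftMat`, transitive in `ℓ`, `det`-preserving);
* `GTPattern k` — chains `T = (λ^{(j)})_{j ≤ k}` of integral weights `λ^{(j)} : Fin j → ℤ` (ALL
  integer chains; a chain that is not a genuine pattern has component `0`, so quantifying over all
  chains contains the printed statements, and — as for the weights `χ` of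
  `BDGIL24IsotypicNaturalProofs.lean` — no sign/duality convention of `coordRep` enters);
* `gtSubspace ρ T = ⨅_j hwSubrep (ρ ∘ glLift) (λ^{(j)})` — **the `T`-isotypic component**, with
  `hwSubrep` (span of the translates of the highest-weight vectors of the given weight = the
  isotypic component, Goodman–Wallach §4.1.6) exactly as in the statement file;
* `thm_1_1_gt` — Thm. 1.1 (4) in the house style of `thm_1_1_weight/_isotypic/_hwv`: the
  projection `Δ'` of `Δ` onto the `T`-isotypic space is characterised by `Δ' ∈ V_T`,
  `Δ − Δ' ∈ ⨆_{T' ≠ T} V_{T'}`; `cc = affComplexity`; absolute constant existential; `1 ≤ d`.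

## The proof (`thm_1_1_gt_holds`, `C = 6`; a disclosed substitution for the printed route)

The paper builds, for each `T`, an element `Y_T ∈ U(𝔤𝔩_k)` from Casimir operators (Cor. 5.8) and
implements it on circuits (Thm. 5.10, PBW). As for items (1)–(3) (`BDGIL24*ProjectionProofs`), the
paper's own size measure `cc` (affine linear forms free at the inputs, so `cc(g · Δ) = cc(Δ)`)
allows the ELEMENTARY orbit-span route, which gives a sharper bound: the `T`-component of `Δ` lies
in `M = span (GL_k · Δ)`, because `M` (finite-dimensional, `GL_k`-stable) is the sum of its
intersections with the `V_T` — **refinement** (`le_iSup_inf_gtSubspace`): by downward induction on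
the level `n`, each piece `M ∩ ⋂_{j > n} B^{(j)}` is stable under `diag(GL_n, 1)` and is therefore
the sum of its intersections with the isotypic components of the (rational:
`isRationalRep_comp_glLift`) restriction to `GL_n` (`le_iSup_inf_hwSubrep`, from
`le_span_translates_highestWeight`: a finite-dimensional stable subspace is spanned by the
translates of its own highest-weight vectors, complete reducibility in characteristic `0`). Every
element of `M` has `cc ≤ (δd+1)^{k²}(s+2)` (`affComplexity_le_of_mem_span_orbit`: `dim M ≤
(δd+1)^{k²}`, each translate costs `≤ s`), so (`thm_1_1_gt_sharp`)
`cc(Δ') ≤ (δd+1)^{k²}(s+2) ≤ 6 s k^{2k²}(δd)^{2k³} ≤ 6 s k^{2k²}(δd)^{2k⁴}` (`orbit_cost_le`,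
`gt_cost_le`; the affine case `deg Δ ≤ 1` is free).

Uniqueness of `Δ'` ("THE projection": the `V_T` are independent and exhaustive) is proved in the
companion (theorems only) file `BDGIL24GelfandTsetlinUniqueness.lean`.

NOT typed here: the multiplicity-freeness of the branching `GL_k ↓ GL_{k-1}` (interlacing rule,
§4.5 p0024.txt:L13–L17; "each `T`-isotypic component of an irreducible `V` is 1-dimensional"),
the Casimir elements `C_{ℓ,p}` / Perelomov–Popov (§4.4–§4.5) and the projectors `Y_T` (Cor. 5.8,
Thm. 5.10) — not needed for the typed statement under this route. Honest framing: representation-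
theoretic bookkeeping about the FORM of metapolynomials; nothing here bears on `VP ≠ VNP`.

## References
* [BergEtAl2024] arXiv:2411.03444: §1 (p.4–5), Thm. 1.1 (4), §4.5 (p.22–24), Cor. 5.8, Thm. 5.10.
* [GoodmanWallachGTM255] R. Goodman, N. Wallach, *Symmetry, Representations, and Invariants*,
  §4.1.6 (isotypic decomposition), Thm. 3.3.11 (complete reducibility), §8.1.1–8.1.2 (branching
  `GL_n ↓ GL_{n-1}`, Gelfand–Tsetlin bases).

## Mathlib and tree
Mathlib: `Matrix.fromBlocks` (`fromBlocks_multiply`, `fromBlocks_one`, `det_fromBlocks_zero₂₁`),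
`Matrix.reindex`/`submatrix_mul_equiv`, `finSumFinEquiv`, `Units.map`, `MvPolynomial.bind₁`,
`Submodule.mem_iSup_iff_exists_finsupp`, `Function.update`. Tree: `hwSubrep`, `affComplexity`,
`coordRep`, `IsRationalRep`, `isRationalRep_coordRep`, `le_span_translates_highestWeight`,
`exists_finset_forall_coordRep_mem_span`, `affComplexity_le_of_mem_span_orbit`, `orbit_cost_le`,
`span_orbit_le_comap`, `self_mem_span_orbit`, `map_hwSubrep_le` (BDGIL24 cluster files).
-/

noncomputable section

open MvPolynomial
open scoped BigOperators

namespace Literature.Barriers.ValiantsHypothesis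

namespace BergEtAl2024

open Literature.Computability.AlgebraicComplexity Literature.NumberTheory.DiophantineGeometry

/-! ### The block embedding `GL_ℓ ↪ GL_k`, `g ↦ diag(g, 1)` -/

section GLLift

variable {K : Type*} [CommRing K] {ℓ k : ℕ}

/-- The index equivalence `Fin ℓ ⊕ Fin (k - ℓ) ≃ Fin k` for `ℓ ≤ k` (first block = the first `ℓ`
coordinates). [folklore] -/
def liftEquiv (h : ℓ ≤ k) : Fin ℓ ⊕ Fin (k - ℓ) ≃ Fin k :=
  finSumFinEquiv.trans (finCongr (Nat.add_sub_of_le h))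

/-- The first block occupies the coordinates `< ℓ`. [folklore] -/
private theorem liftEquiv_inl (h : ℓ ≤ k) (a : Fin ℓ) : ((liftEquiv h (Sum.inl a) : Fin k) : ℕ) = a := by
  simp [liftEquiv]

/-- The second block occupies the coordinates `≥ ℓ`. [folklore] -/
private theorem liftEquiv_inr (h : ℓ ≤ k) (b : Fin (k - ℓ)) :
    ((liftEquiv h (Sum.inr b) : Fin k) : ℕ) = ℓ + b := by
  simp [liftEquiv]

/-- Coordinates `< ℓ` come from the first block. [folklore] -/
private theorem liftEquiv_symm_of_lt (h : ℓ ≤ k) {i : Fin k} (hi : (i : ℕ) < ℓ) :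
    (liftEquiv h).symm i = Sum.inl ⟨i, hi⟩ := by
  rw [Equiv.symm_apply_eq]
  exact Fin.ext (by rw [liftEquiv_inl])

/-- Coordinates `≥ ℓ` come from the second block. [folklore] -/
private theorem liftEquiv_symm_of_le (h : ℓ ≤ k) {i : Fin k} (hi : ℓ ≤ (i : ℕ)) :
    (liftEquiv h).symm i = Sum.inr ⟨i - ℓ, by omega⟩ := by
  rw [Equiv.symm_apply_eq]
  exact Fin.ext (by rw [liftEquiv_inr]; simp; omega)

/-- The matrix `diag(A, 1)` of size `k` with upper-left block `A` of size `ℓ ≤ k`. [folklore] -/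
def liftMat (h : ℓ ≤ k) (A : Matrix (Fin ℓ) (Fin ℓ) K) : Matrix (Fin k) (Fin k) K :=
  Matrix.reindex (liftEquiv h) (liftEquiv h) (Matrix.fromBlocks A 0 0 1)

/-- Entries of `diag(A, 1)` through the block decomposition. [folklore] -/
private theorem liftMat_apply (h : ℓ ≤ k) (A : Matrix (Fin ℓ) (Fin ℓ) K) (i j : Fin k) :
    liftMat h A i j = Matrix.fromBlocks A 0 0 (1 : Matrix (Fin (k - ℓ)) (Fin (k - ℓ)) K)
      ((liftEquiv h).symm i) ((liftEquiv h).symm j) := rfl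

/-- Upper-left block of `diag(A, 1)` is `A` (the inclusion `𝔤𝔩_ℓ ⊂ 𝔤𝔩_k` of [BDGIL24, §4.5]).
[cite: BergEtAl2024, §4.5, p.23 (PDF p.24)] locator: paper:arxiv-2411.03444 p0024.txt:L2–L4 -/
theorem liftMat_apply_of_lt_of_lt (h : ℓ ≤ k) (A : Matrix (Fin ℓ) (Fin ℓ) K) {i j : Fin k}
    (hi : (i : ℕ) < ℓ) (hj : (j : ℕ) < ℓ) : liftMat h A i j = A ⟨i, hi⟩ ⟨j, hj⟩ := by
  rw [liftMat_apply, liftEquiv_symm_of_lt h hi, liftEquiv_symm_of_lt h hj, Matrix.fromBlocks_apply₁₁]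

/-- Upper-right block of `diag(A, 1)` is `0` ("the `k`-th column identically equal to `0`").
[cite: BergEtAl2024, §4.5, p.23 (PDF p.24)] locator: paper:arxiv-2411.03444 p0024.txt:L2–L4 -/
theorem liftMat_apply_of_lt_of_le (h : ℓ ≤ k) (A : Matrix (Fin ℓ) (Fin ℓ) K) {i j : Fin k}
    (hi : (i : ℕ) < ℓ) (hj : ℓ ≤ (j : ℕ)) : liftMat h A i j = 0 := by
  rw [liftMat_apply, liftEquiv_symm_of_lt h hi, liftEquiv_symm_of_le h hj, Matrix.fromBlocks_apply₁₂]
  rfl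

/-- Lower-left block of `diag(A, 1)` is `0` ("the `k`-th row identically equal to `0`").
[cite: BergEtAl2024, §4.5, p.23 (PDF p.24)] locator: paper:arxiv-2411.03444 p0024.txt:L2–L4 -/
theorem liftMat_apply_of_le_of_lt (h : ℓ ≤ k) (A : Matrix (Fin ℓ) (Fin ℓ) K) {i j : Fin k}
    (hi : ℓ ≤ (i : ℕ)) (hj : (j : ℕ) < ℓ) : liftMat h A i j = 0 := by
  rw [liftMat_apply, liftEquiv_symm_of_le h hi, liftEquiv_symm_of_lt h hj, Matrix.fromBlocks_apply₂₁]
  rfl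

/-- Lower-right block of `diag(A, 1)` is the identity (group-level form of the inclusion).
[cite: BergEtAl2024, §4.5, p.23 (PDF p.24)] locator: paper:arxiv-2411.03444 p0024.txt:L2–L4 -/
theorem liftMat_apply_of_le_of_le (h : ℓ ≤ k) (A : Matrix (Fin ℓ) (Fin ℓ) K) {i j : Fin k}
    (hi : ℓ ≤ (i : ℕ)) (hj : ℓ ≤ (j : ℕ)) : liftMat h A i j = if i = j then 1 else 0 := by
  rw [liftMat_apply, liftEquiv_symm_of_le h hi, liftEquiv_symm_of_le h hj, Matrix.fromBlocks_apply₂₂,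
    Matrix.one_apply]
  congr 1
  simp only [Fin.ext_iff, eq_iff_iff]
  omega

/-- `diag(1, 1) = 1`: the inclusion preserves the unit.
[cite: BergEtAl2024, §4.5, p.23 (PDF p.24)] locator: paper:arxiv-2411.03444 p0024.txt:L2–L4 -/
theorem liftMat_one (h : ℓ ≤ k) : liftMat h (1 : Matrix (Fin ℓ) (Fin ℓ) K) = 1 := by
  rw [liftMat, Matrix.fromBlocks_one, Matrix.reindex_apply, Matrix.submatrix_one_equiv]

/-- `diag(AB, 1) = diag(A, 1) diag(B, 1)`: the inclusion is multiplicative.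
[cite: BergEtAl2024, §4.5, p.23 (PDF p.24)] locator: paper:arxiv-2411.03444 p0024.txt:L2–L4 -/
theorem liftMat_mul (h : ℓ ≤ k) (A B : Matrix (Fin ℓ) (Fin ℓ) K) :
    liftMat h (A * B) = liftMat h A * liftMat h B := by
  simp only [liftMat, Matrix.reindex_apply]
  rw [Matrix.submatrix_mul_equiv, Matrix.fromBlocks_multiply]
  simp

/-- `det diag(A, 1) = det A`.
[cite: BergEtAl2024, §4.5, p.23 (PDF p.24)] locator: paper:arxiv-2411.03444 p0024.txt:L2–L4 -/
theorem det_liftMat (h : ℓ ≤ k) (A : Matrix (Fin ℓ) (Fin ℓ) K) : (liftMat h A).det = A.det := by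
  rw [liftMat, Matrix.reindex_apply, Matrix.det_submatrix_equiv_self, Matrix.det_fromBlocks_zero₂₁,
    Matrix.det_one, mul_one]

/-- `A ↦ diag(A, 1)` as a monoid homomorphism of matrices (plumbing for `glLift`). [folklore] -/
def liftMatHom (h : ℓ ≤ k) : Matrix (Fin ℓ) (Fin ℓ) K →* Matrix (Fin k) (Fin k) K where
  toFun := liftMat h
  map_one' := liftMat_one h
  map_mul' := liftMat_mul h

/-- **The block embedding `GL_ℓ → GL_k`, `g ↦ diag(g, 1_{k-ℓ})`** (`ℓ ≤ k`): the group-level form of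
the inclusion `𝔤𝔩_ℓ ⊂ 𝔤𝔩_k` "as the subalgebra of matrices having the last rows and columns
identically `0`" along which [BDGIL24, §4.5] restricts representations (Gelfand–Tsetlin chain
`𝔤𝔩_1 ⊂ 𝔤𝔩_2 ⊂ ⋯ ⊂ 𝔤𝔩_k`).
[cite: BergEtAl2024, §4.5, p.23 (PDF p.24)] locator: paper:arxiv-2411.03444 p0024.txt:L2–L4 -/
def glLift (h : ℓ ≤ k) : GL (Fin ℓ) K →* GL (Fin k) K :=
  Units.map (liftMatHom h)

/-- The matrix of `glLift h g` is `diag(g, 1)`.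
[cite: BergEtAl2024, §4.5, p.23 (PDF p.24)] locator: paper:arxiv-2411.03444 p0024.txt:L2–L4 -/
theorem coe_glLift (h : ℓ ≤ k) (g : GL (Fin ℓ) K) :
    ((glLift h g : GL (Fin k) K) : Matrix (Fin k) (Fin k) K) = liftMat h (g : Matrix (Fin ℓ) (Fin ℓ) K) :=
  rfl

/-- Master entry formula for `diag(A, 1)`.
[cite: BergEtAl2024, §4.5, p.23 (PDF p.24)] locator: paper:arxiv-2411.03444 p0024.txt:L2–L4 -/
theorem liftMat_apply_eq (h : ℓ ≤ k) (A : Matrix (Fin ℓ) (Fin ℓ) K) (i j : Fin k) :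
    liftMat h A i j = if hi : (i : ℕ) < ℓ then (if hj : (j : ℕ) < ℓ then A ⟨i, hi⟩ ⟨j, hj⟩ else 0)
      else (if i = j then 1 else 0) := by
  by_cases hi : (i : ℕ) < ℓ
  · by_cases hj : (j : ℕ) < ℓ
    · rw [dif_pos hi, dif_pos hj, liftMat_apply_of_lt_of_lt h A hi hj]
    · rw [dif_pos hi, dif_neg hj, liftMat_apply_of_lt_of_le h A hi (not_lt.1 hj)]
  · by_cases hj : (j : ℕ) < ℓ
    · rw [dif_neg hi, liftMat_apply_of_le_of_lt h A (not_lt.1 hi) hj]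
      have : i ≠ j := fun hij => hi (hij ▸ hj)
      rw [if_neg this]
    · rw [dif_neg hi, liftMat_apply_of_le_of_le h A (not_lt.1 hi) (not_lt.1 hj)]

/-- Transitivity of the block embeddings: `diag(diag(A, 1), 1) = diag(A, 1)` (the CHAIN
`𝔤𝔩_1 ⊂ 𝔤𝔩_2 ⊂ ⋯ ⊂ 𝔤𝔩_k` of [BDGIL24, §4.5] is compatible).
[cite: BergEtAl2024, §4.5, p.23 (PDF p.24)] locator: paper:arxiv-2411.03444 p0024.txt:L2–L4 -/
theorem liftMat_liftMat {m : ℕ} (h₁ : m ≤ ℓ) (h₂ : ℓ ≤ k) (A : Matrix (Fin m) (Fin m) K) :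
    liftMat h₂ (liftMat h₁ A) = liftMat (h₁.trans h₂) A := by
  ext i j
  simp only [liftMat_apply_eq, Fin.ext_iff]
  split_ifs <;> first | rfl | omega

/-- `glLift` along `m ≤ ℓ ≤ k` composes (chain of inclusions).
[cite: BergEtAl2024, §4.5, p.23 (PDF p.24)] locator: paper:arxiv-2411.03444 p0024.txt:L2–L4 -/
theorem glLift_comp_glLift {m : ℕ} (h₁ : m ≤ ℓ) (h₂ : ℓ ≤ k) :
    (glLift (K := K) h₂).comp (glLift h₁) = glLift (h₁.trans h₂) := by
  ext g : 1
  exact Units.ext (liftMat_liftMat h₁ h₂ _)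

/-- `glLift` along `m ≤ ℓ ≤ k` composes (pointwise; chain of inclusions).
[cite: BergEtAl2024, §4.5, p.23 (PDF p.24)] locator: paper:arxiv-2411.03444 p0024.txt:L2–L4 -/
theorem glLift_glLift {m : ℕ} (h₁ : m ≤ ℓ) (h₂ : ℓ ≤ k) (g : GL (Fin m) K) :
    glLift h₂ (glLift h₁ g) = glLift (h₁.trans h₂) g :=
  Units.ext (liftMat_liftMat h₁ h₂ _)

/-- The block embedding along `k ≤ k` is the identity.
[cite: BergEtAl2024, §4.5, p.23 (PDF p.24)] locator: paper:arxiv-2411.03444 p0024.txt:L2–L4 -/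
theorem liftMat_refl (A : Matrix (Fin k) (Fin k) K) : liftMat le_rfl A = A := by
  ext i j
  rw [liftMat_apply_eq, dif_pos i.2, dif_pos j.2]

/-- `glLift` along `k ≤ k` is the identity.
[cite: BergEtAl2024, §4.5, p.23 (PDF p.24)] locator: paper:arxiv-2411.03444 p0024.txt:L2–L4 -/
theorem glLift_refl (g : GL (Fin k) K) : glLift le_rfl g = g :=
  Units.ext (liftMat_refl _)

/-- `diag(A, 1)` is upper triangular when `A` is (the inclusion respects the Borel subgroups).
[cite: BergEtAl2024, §4.5, p.23 (PDF p.24)] locator: paper:arxiv-2411.03444 p0024.txt:L2–L4 -/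
theorem blockTriangular_liftMat (h : ℓ ≤ k) {A : Matrix (Fin ℓ) (Fin ℓ) K}
    (hA : A.BlockTriangular id) : (liftMat h A).BlockTriangular id := by
  intro i j hij
  simp only [id] at hij
  rw [liftMat_apply_eq]
  split_ifs with hi hj hij'
  · exact hA (show (id ⟨(j : ℕ), hj⟩ : Fin ℓ) < id ⟨i, hi⟩ from Fin.lt_def.2 (Fin.lt_def.1 hij))
  · rfl
  · exact absurd hij' (ne_of_gt hij)
  · rfl

/-- Diagonal entries of `diag(A, 1)`: those of `A`, then `1`'s (the inclusion respects the tori).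
[cite: BergEtAl2024, §4.5, p.23 (PDF p.24)] locator: paper:arxiv-2411.03444 p0024.txt:L2–L4 -/
theorem liftMat_apply_self (h : ℓ ≤ k) (A : Matrix (Fin ℓ) (Fin ℓ) K) (i : Fin k) :
    liftMat h A i i = if hi : (i : ℕ) < ℓ then A ⟨i, hi⟩ ⟨i, hi⟩ else 1 := by
  rw [liftMat_apply_eq]
  split_ifs with hi h
  · rfl
  · rfl
  · exact absurd rfl h

end GLLift

/-! ### Restriction of a representation of `GL_k` to `GL_ℓ` along the block embedding -/

section Restrict

variable {K V : Type*} [Field K] [AddCommGroup V] [Module K V] {ℓ k : ℕ}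

/-- The entries of `diag(A, 1)` are polynomial (of degree `≤ 1`) in the entries of `A`: the
substitution realising them. [folklore] -/
private def liftEntryPoly (ℓ : ℕ) (ij : Fin k × Fin k) : MvPolynomial (Fin ℓ × Fin ℓ) K :=
  if hi : (ij.1 : ℕ) < ℓ then (if hj : (ij.2 : ℕ) < ℓ then X (⟨ij.1, hi⟩, ⟨ij.2, hj⟩) else 0)
  else C (if ij.1 = ij.2 then 1 else 0)

/-- Evaluating a substitution: `(P ∘ f)(x) = P(f(x))`. [folklore] -/
private theorem eval_bind₁_eq {σ τ R : Type*} [CommSemiring R] (x : τ → R) (f : σ → MvPolynomial τ R)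
    (P : MvPolynomial σ R) : eval x (bind₁ f P) = eval (fun i => eval x (f i)) P := by
  rw [eval, eval₂Hom_bind₁]
  rfl

/-- The substitution `liftEntryPoly` evaluates to the entries of `diag(A, 1)`. [folklore] -/
private theorem eval_liftEntryPoly (h : ℓ ≤ k) (A : Matrix (Fin ℓ) (Fin ℓ) K) (ij : Fin k × Fin k) :
    eval (fun ab : Fin ℓ × Fin ℓ => A ab.1 ab.2) (liftEntryPoly ℓ ij) = liftMat h A ij.1 ij.2 := by
  rw [liftMat_apply_eq, liftEntryPoly]
  split_ifs <;> simp

/-- **Restriction to `GL_ℓ` preserves rationality**: if `ρ` is a rational representation of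
`GL_k`, so is `ρ ∘ diag(·, 1)` of `GL_ℓ` (the entries of `diag(g, 1)` are polynomial in those of
`g` and `det diag(g, 1) = det g`) — "Every representation `V` of `𝔟` can be regarded as a
representation of `𝔞` using this inclusion … the restriction of `V` to `𝔞`" stays in the rational
category. [cite: BergEtAl2024, §4.5, p.22 (PDF p.23)] locator: paper:arxiv-2411.03444 p0023.txt:L8–L12 -/
theorem isRationalRep_comp_glLift {ρ : Representation K (GL (Fin k) K) V} (hρ : IsRationalRep ρ)
    (h : ℓ ≤ k) : IsRationalRep (ρ.comp (glLift h)) := by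
  intro v φ
  obtain ⟨P, r, hP⟩ := hρ v φ
  refine ⟨bind₁ (liftEntryPoly ℓ) P, r, fun g => ?_⟩
  have hg := hP (glLift h g)
  rw [coe_glLift, det_liftMat] at hg
  rw [MonoidHom.comp_apply, hg, eval_bind₁_eq]
  congr 2
  funext ij
  rw [eval_liftEntryPoly]

/-- A subrepresentation of `ρ` is a subrepresentation of any restriction `ρ ∘ φ` (plumbing). [folklore] -/
def subrepOfComp {G H : Type*} [Group G] [Group H] {ρ : Representation K G V}
    (φ : H →* G) (U : Subrepresentation ρ) : Subrepresentation (ρ.comp φ) :=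
  ⟨U.toSubmodule, fun h _ hx => U.apply_mem_toSubmodule (φ h) hx⟩

/-- `subrepOfComp` does not change the underlying submodule. [folklore] -/
private theorem subrepOfComp_toSubmodule {G H : Type*} [Group G] [Group H]
    {ρ : Representation K G V} (φ : H →* G) (U : Subrepresentation ρ) :
    (subrepOfComp φ U).toSubmodule = U.toSubmodule := rfl

/-- Local finiteness (every vector in a finite-dimensional subrepresentation) passes to
restrictions ("Every representation `V` of `𝔟` can be regarded as a representation of `𝔞`").
[cite: BergEtAl2024, §4.5, p.22 (PDF p.23)] locator: paper:arxiv-2411.03444 p0023.txt:L8–L12 -/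
theorem locallyFinite_comp {G H : Type*} [Group G] [Group H] {ρ : Representation K G V}
    (hlf : ∀ v : V, ∃ U : Subrepresentation ρ, v ∈ U.toSubmodule ∧ FiniteDimensional K U.toSubmodule)
    (φ : H →* G) :
    ∀ v : V, ∃ U : Subrepresentation (ρ.comp φ), v ∈ U.toSubmodule ∧
      FiniteDimensional K U.toSubmodule := by
  intro v
  obtain ⟨U, hv, hU⟩ := hlf v
  exact ⟨subrepOfComp φ U, hv, hU⟩

end Restrict

/-! ### Gelfand–Tsetlin patterns and the `T`-isotypic components -/

section GT

variable {K V : Type*} [Field K] [AddCommGroup V] [Module K V] {k : ℕ}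

/-- Levels `j : Fin (k+1)` of a chain satisfy `j ≤ k` (index bookkeeping for `1 ≤ ℓ ≤ k`).
[cite: BergEtAl2024, §4.5, p.23 (PDF p.24)] locator: paper:arxiv-2411.03444 p0024.txt:L22–L23 -/
theorem level_le (j : Fin (k + 1)) : (j : ℕ) ≤ k := Nat.le_of_lt_succ j.2

/-- **Gelfand–Tsetlin patterns (index type).** A pattern for `GL_k` is a chain of integral weights
`T = (λ^{(0)}, λ^{(1)}, …, λ^{(k)})`, `λ^{(j)} : Fin j → ℤ` a weight of `GL_j` (level `0` is the
trivial group and carries no information). [BDGIL24, §4.5]: "A Gelfand–Tsetlin pattern is given by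
a sequence `λ^{(1)} → λ^{(2)} → ⋯ → λ^{(k)}`, that is, by integers `λ^{(ℓ)}_i` with `1 ≤ ℓ ≤ k`,
`1 ≤ i ≤ ℓ` such that `λ^{(ℓ)}_i ≥ λ^{(ℓ-1)}_i ≥ λ^{(ℓ)}_{i+1}`"; when `λ^{(k)}` is a partition these
"are in bijective correspondence with semistandard Young tableaux filled with numbers from
`{1, …, k}`" (`T ↦ λ^{(ℓ)} =` shape of the boxes labelled `≤ ℓ`). ALL integer chains are admitted
here (no interlacing condition): a chain that is not a genuine pattern simply has `T`-isotypic
component `0`, so statements quantified over all chains contain the printed ones; as for weights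
in `BDGIL24IsotypicNaturalProofs.lean`, no sign/duality convention enters.
[cite: BergEtAl2024, §4.5, p.23 (PDF p.24)] locator: paper:arxiv-2411.03444 p0024.txt:L22–L24, L66–L72 -/
abbrev GTPattern (k : ℕ) : Type := (j : Fin (k + 1)) → Weight (Fin j)

/-- **The `T`-isotypic component (Gelfand–Tsetlin / `GZ`-isotypic space) of a representation `ρ`
of `GL_k`** for a chain `T = (λ^{(j)})_{j ≤ k}`: the vectors lying, for every level `j ≤ k`, in the
`λ^{(j)}`-isotypic component (`hwSubrep`, as in `BDGIL24IsotypicNaturalProofs.lean`) of the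
restriction of `ρ` to `GL_j ↪ GL_k`, `g ↦ diag(g, 1)`. [BDGIL24, §1]: "Each `λ`-isotypic component
decomposes even further into a direct sum of subspaces with one summand for each semistandard
tableau `T` of shape `λ`. We call the component for `T` the `T`-isotypic component"; §4.5: these
are the `GZ`-isotypic spaces of the Gelfand–Tsetlin algebra generated by the centres `Z(𝔤𝔩_ℓ)`,
`ℓ ≤ k`, on which "`Z(𝔤𝔩_ℓ)` acts via the central character `χ_{λ^{(ℓ)}}`" — i.e. (central characters
separate isotypic components, [BDGIL24, Thm. 4.11]) the intersection over `ℓ` of the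
`λ^{(ℓ)}`-isotypic components of the restrictions, which is the reading typed here (group level,
any field). [cite: BergEtAl2024, §1, p.4 (PDF p.5) and §4.5, p.22 (PDF p.23)] locator: paper:arxiv-2411.03444 p0005.txt:L5–L9; p0023.txt:L40–L47, p0024.txt:L1 -/
def gtSubspace (ρ : Representation K (GL (Fin k) K) V) (T : GTPattern k) : Submodule K V :=
  ⨅ j : Fin (k + 1), hwSubrep (ρ.comp (glLift (level_le j))) (T j)

/-- Membership in the `T`-isotypic component, unfolded. [cite: BergEtAl2024, §4.5, p.22 (PDF p.23)] locator: paper:arxiv-2411.03444 p0023.txt:L40–L47 -/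
theorem mem_gtSubspace_iff (ρ : Representation K (GL (Fin k) K) V) (T : GTPattern k) (v : V) :
    v ∈ gtSubspace ρ T ↔ ∀ j : Fin (k + 1), v ∈ hwSubrep (ρ.comp (glLift (level_le j))) (T j) := by
  rw [gtSubspace, Submodule.mem_iInf]

/-- The restriction of `ρ` along `GL_k ≤ GL_k` is `ρ` (top of the chain).
[cite: BergEtAl2024, §4.5, p.22 (PDF p.23)] locator: paper:arxiv-2411.03444 p0023.txt:L8–L12 -/
theorem comp_glLift_refl (ρ : Representation K (GL (Fin k) K) V) (h : k ≤ k) :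
    ρ.comp (glLift h) = ρ := by
  ext g : 1
  rw [MonoidHom.comp_apply, glLift_refl]

/-- **The `T`-isotypic component lies in the `λ^{(k)}`-isotypic component** (top level of the
chain: "the `λ`-isotypic component decomposes further into … `T`-isotypic components").
[cite: BergEtAl2024, §1, p.4 (PDF p.5)] locator: paper:arxiv-2411.03444 p0005.txt:L5–L7 -/
theorem gtSubspace_le_hwSubrep_last (ρ : Representation K (GL (Fin k) K) V) (T : GTPattern k) :
    gtSubspace ρ T ≤ hwSubrep ρ (T (Fin.last k)) := by
  refine (iInf_le _ (Fin.last k)).trans ?_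
  change hwSubrep (σ := Fin k) (ρ.comp (glLift le_rfl)) (T (Fin.last k)) ≤ hwSubrep ρ (T (Fin.last k))
  rw [comp_glLift_refl]

end GT

/-! ### Theorem 1.1 (4): the statement -/

/-- **Theorem 1.1 (4) (`T`-isotypic / Gelfand–Tsetlin components).** "Let
`Δ : ℂ[x₁,…,x_k]_d → ℂ` be a metapolynomial of format `(δ, d, k)` computed by an algebraic circuit
of size `s`. Then … 4. For every semistandard tableau `T` of shape `λ ⊢ dδ` the projection of `Δ`
onto the `T`-isotypic space can be computed by a circuit of size `O(s k^{2k²} (δd)^{2k⁴})`."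
Typed in the house style of `thm_1_1_weight` / `thm_1_1_isotypic` / `thm_1_1_hwv`
(`BDGIL24IsotypicNaturalProofs.lean`): for every chain of integer weights `T` (non-occurring
chains have projection `0`), the projection `Δ'` being characterised by `Δ' ∈ V_T`,
`Δ - Δ' ∈ ⨆_{T' ≠ T} V_{T'}` (`V_T = gtSubspace (coordRep) T`); `cc` = `affComplexity` on both
sides, absolute constant existential; degenerate format `d = 0` excluded (`1 ≤ d`) as for items
(1)–(3) (val-lit referee row np/123). Proved below (`thm_1_1_gt_holds`).
[cite: BergEtAl2024, Thm. 1.1 (4), p.4 (PDF p.5)] locator: paper:arxiv-2411.03444 p0005.txt:L83–L85 -/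
def thm_1_1_gt : Prop :=
  ∃ C : ℕ, ∀ (δ d k s : ℕ) (Δ : MvPolynomial (DegIdx (Fin k) d) ℂ), 1 ≤ d → Δ.IsHomogeneous δ →
    affComplexity Δ ≤ s → ∀ T : GTPattern k,
      ∃ Δ' : MvPolynomial (DegIdx (Fin k) d) ℂ,
        Δ' ∈ gtSubspace (coordRep (Fin k) ℂ d) T ∧
        Δ - Δ' ∈ ⨆ T' ∈ {T' : GTPattern k | T' ≠ T}, gtSubspace (coordRep (Fin k) ℂ d) T' ∧
        affComplexity Δ' ≤ C * s * k ^ (2 * k ^ 2) * (δ * d) ^ (2 * k ^ 4)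

/-! ### Refinement of the level-wise isotypic decompositions inside a stable subspace -/

section Refinement

variable {K V : Type*} [Field K] [AddCommGroup V] [Module K V] {k : ℕ}

/-- **Compatibility**: a finite-dimensional `GL_n`-stable subspace `U` of a rational
representation (characteristic `0`) is contained in the sum of its intersections with the
isotypic components — it is spanned by the translates of ITS OWN highest-weight vectors
(`le_span_translates_highestWeight`). [cite: GoodmanWallachGTM255, §4.1.6 with Thm. 3.3.11] -/
theorem le_iSup_inf_hwSubrep [CharZero K] {n : ℕ} {ρ' : Representation K (GL (Fin n) K) V}
    (hρ' : IsRationalRep ρ') (U : Submodule K V) (hU : ∀ g, U ≤ U.comap (ρ' g))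
    [FiniteDimensional K U] : U ≤ ⨆ μ : Weight (Fin n), U ⊓ hwSubrep ρ' μ := by
  refine (le_span_translates_highestWeight hρ' U hU).trans (Submodule.span_le.2 ?_)
  rintro _ ⟨g, v, χ, hvU, hvχ, rfl⟩
  exact Submodule.mem_iSup_of_mem χ ⟨hU g hvU, Submodule.subset_span ⟨g, v, hvχ, rfl⟩⟩

/-- The partial intersections over the levels `j ≥ n` of a chain (plumbing for the refinement
induction). [folklore] -/
private def gtUpper (ρ : Representation K (GL (Fin k) K) V) (n : ℕ) (T : GTPattern k) : Submodule K V :=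
  ⨅ j : Fin (k + 1), ⨅ (_ : n ≤ (j : ℕ)), hwSubrep (ρ.comp (glLift (level_le j))) (T j)

/-- All levels `≥ 0`: the full `T`-isotypic component. [folklore] -/
private theorem gtUpper_zero_le (ρ : Representation K (GL (Fin k) K) V) (T : GTPattern k) :
    gtUpper ρ 0 T ≤ gtSubspace ρ T :=
  le_iInf fun j => (iInf_le _ j).trans (iInf_le _ (Nat.zero_le _))

/-- No level is `≥ k + 1`: the empty intersection is everything. [folklore] -/
private theorem gtUpper_top (ρ : Representation K (GL (Fin k) K) V) (T : GTPattern k) :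
    gtUpper ρ (k + 1) T = ⊤ := by
  refine eq_top_iff.2 (le_iInf fun j => le_iInf fun hj => ?_)
  exact absurd hj (not_le.2 j.2)

/-- The level-`j` isotypic components are stable under the level-`m` subgroup `diag(GL_m, 1)`,
`m ≤ j` (restriction along the chain). [cite: BergEtAl2024, §4.5, p.22 (PDF p.23)] locator: paper:arxiv-2411.03444 p0023.txt:L8–L12 -/
theorem hwSubrep_comp_stable (ρ : Representation K (GL (Fin k) K) V) {m j : ℕ} (hm : m ≤ j)
    (hj : j ≤ k) (μ : Weight (Fin j)) (g : GL (Fin m) K) {x : V}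
    (hx : x ∈ hwSubrep (ρ.comp (glLift hj)) μ) :
    ρ (glLift (hm.trans hj) g) x ∈ hwSubrep (ρ.comp (glLift hj)) μ := by
  rw [← glLift_glLift hm hj]
  exact map_hwSubrep_le (ρ.comp (glLift hj)) μ (glLift hm g) (Submodule.mem_map_of_mem hx)

/-- The partial intersection over the levels `≥ n` is stable under `diag(GL_m, 1)` for `m ≤ n`
(each level-`j` isotypic component is a `GL_j`-, hence `GL_m`-subrepresentation).
[folklore] -/
private theorem gtUpper_stable (ρ : Representation K (GL (Fin k) K) V) {m n : ℕ} (hmn : m ≤ n)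
    (hm : m ≤ k) (T : GTPattern k) (g : GL (Fin m) K) {x : V} (hx : x ∈ gtUpper ρ n T) :
    ρ (glLift hm g) x ∈ gtUpper ρ n T := by
  simp only [gtUpper, Submodule.mem_iInf] at hx ⊢
  intro j hj
  exact hwSubrep_comp_stable ρ (hmn.trans hj) (level_le j) (T j) g (hx j hj)

/-- One refinement step: `Q_{n+1}(T) ⊓ B^{(n)}_μ ≤ Q_n(T[n ↦ μ])`. [folklore] -/
private theorem gtUpper_succ_inf_le (ρ : Representation K (GL (Fin k) K) V) {n : ℕ} (hn : n ≤ k)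
    (T : GTPattern k) (μ : Weight (Fin n)) :
    gtUpper ρ (n + 1) T ⊓ hwSubrep (ρ.comp (glLift hn)) μ ≤
      gtUpper ρ n (Function.update T ⟨n, Nat.lt_succ_of_le hn⟩ μ) := by
  refine le_iInf fun j => le_iInf fun hj => ?_
  by_cases hjn : j = ⟨n, Nat.lt_succ_of_le hn⟩
  · subst hjn
    rw [Function.update_self]
    exact inf_le_right
  · rw [Function.update_of_ne hjn]
    have hj' : n + 1 ≤ (j : ℕ) := by
      rcases Nat.lt_or_eq_of_le hj with h | h
      · exact h
      · exact absurd (Fin.ext h.symm) hjn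
    exact inf_le_left.trans ((iInf_le _ j).trans (iInf_le _ hj'))

/-- **Exhaustion by refinement.** In a rational representation of `GL_k` (characteristic `0`),
every finite-dimensional `GL_k`-stable subspace `W` is the sum of its intersections with the
partial Gelfand–Tsetlin components `Q_n(T)` — downward induction on the level `n`, refining each
piece (stable under `diag(GL_n, 1)`) by the isotypic decomposition of the rational restriction
to `GL_n` (`le_iSup_inf_hwSubrep`). [cite: BergEtAl2024, §4.5 eq. (12)–(13), p.22 (PDF p.23)] locator: paper:arxiv-2411.03444 p0023.txt:L20–L27, L48–L53 -/
private theorem le_iSup_inf_gtUpper [CharZero K] {ρ : Representation K (GL (Fin k) K) V}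
    (hρ : IsRationalRep ρ) (W : Submodule K V) [FiniteDimensional K W]
    (hW : ∀ g, W ≤ W.comap (ρ g)) (d : ℕ) :
    W ≤ ⨆ T : GTPattern k, W ⊓ gtUpper ρ (k + 1 - d) T := by
  induction d with
  | zero =>
    rw [Nat.sub_zero]
    refine le_iSup_of_le (fun _ => 0) ?_
    rw [gtUpper_top, inf_top_eq]
  | succ d ih =>
    by_cases hd : k + 1 ≤ d
    · have h1 : k + 1 - (d + 1) = k + 1 - d := by omega
      rw [h1]
      exact ih
    · set n := k + 1 - (d + 1) with hn
      have hnk : n ≤ k := by omega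
      have hn1 : k + 1 - d = n + 1 := by omega
      rw [hn1] at ih
      refine ih.trans (iSup_le fun T => ?_)
      -- the piece `W ⊓ Q_{n+1}(T)` is finite-dimensional and stable under `diag(GL_n, 1)`
      set U : Submodule K V := W ⊓ gtUpper ρ (n + 1) T with hU
      haveI : FiniteDimensional K U := Submodule.finiteDimensional_of_le (inf_le_left : U ≤ W)
      have hUstab : ∀ g : GL (Fin n) K, U ≤ U.comap ((ρ.comp (glLift hnk)) g) := by
        intro g x hx
        refine ⟨hW _ hx.1, ?_⟩
        exact gtUpper_stable ρ (Nat.le_succ n) hnk T g hx.2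
      refine (le_iSup_inf_hwSubrep (isRationalRep_comp_glLift hρ hnk) U hUstab).trans (iSup_le fun μ => ?_)
      refine le_iSup_of_le (Function.update T ⟨n, Nat.lt_succ_of_le hnk⟩ μ) ?_
      refine le_inf (inf_le_left.trans inf_le_left) ?_
      rw [hU, inf_assoc]
      exact inf_le_right.trans (gtUpper_succ_inf_le ρ hnk T μ)

/-- **A finite-dimensional `GL_k`-stable subspace is the sum of its intersections with the
`T`-isotypic components** (rational representation, characteristic `0`).
[cite: BergEtAl2024, §4.5 eq. (13), p.22 (PDF p.23)] locator: paper:arxiv-2411.03444 p0023.txt:L48–L53 -/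
theorem le_iSup_inf_gtSubspace [CharZero K] {ρ : Representation K (GL (Fin k) K) V}
    (hρ : IsRationalRep ρ) (W : Submodule K V) [FiniteDimensional K W]
    (hW : ∀ g, W ≤ W.comap (ρ g)) :
    W ≤ ⨆ T : GTPattern k, W ⊓ gtSubspace ρ T := by
  have h := le_iSup_inf_gtUpper hρ W hW (k + 1)
  rw [Nat.sub_self] at h
  exact h.trans (iSup_mono fun T => inf_le_inf_left _ (gtUpper_zero_le ρ T))

/-- **The `T`-component of a vector of a stable finite-dimensional subspace `W` exists inside `W`**:
`x = y + (x - y)` with `y ∈ W ∩ V_T` and `x - y ∈ ⨆_{T' ≠ T} V_{T'}`.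
[cite: BergEtAl2024, Thm. 1.1 (4), p.4 (PDF p.5)] locator: paper:arxiv-2411.03444 p0005.txt:L83–L85 -/
theorem exists_gtComponent_mem [CharZero K] {ρ : Representation K (GL (Fin k) K) V}
    (hρ : IsRationalRep ρ) (W : Submodule K V) [FiniteDimensional K W]
    (hW : ∀ g, W ≤ W.comap (ρ g)) {x : V} (hx : x ∈ W) (T : GTPattern k) :
    ∃ y ∈ W, y ∈ gtSubspace ρ T ∧
      x - y ∈ ⨆ T' ∈ {T' : GTPattern k | T' ≠ T}, gtSubspace ρ T' := by
  classical
  obtain ⟨f, hf, hfx⟩ :=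
    (Submodule.mem_iSup_iff_exists_finsupp _ x).1 (le_iSup_inf_gtSubspace hρ W hW hx)
  refine ⟨f T, (hf T).1, (hf T).2, ?_⟩
  have hfx' : ∑ T' ∈ f.support, f T' = x := hfx
  have hsplit : x - f T = ∑ T' ∈ f.support.erase T, f T' := by
    rw [← hfx', sub_eq_iff_eq_add]
    by_cases hT : T ∈ f.support
    · rw [Finset.sum_erase_add _ _ hT]
    · rw [Finset.erase_eq_of_notMem hT, Finsupp.notMem_support_iff.1 hT, add_zero]
  rw [hsplit]
  refine Submodule.sum_mem _ fun T' hT' => ?_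
  exact Submodule.mem_iSup_of_mem T' (Submodule.mem_iSup_of_mem (Finset.ne_of_mem_erase hT')
    (hf T').2)

end Refinement

/-! ### Theorem 1.1 (4): proof -/

section Proof

variable {k d : ℕ}

/-- **Theorem 1.1 (4), sharp form of this route**: the `T`-component of a metapolynomial `Δ` of
format `(δ, d, k)` with `cc ≤ s` lies in the orbit span `span (GL_k · Δ)` and has
`cc ≤ (δd + 1)^{k²} (s + 2)`. [cite: BergEtAl2024, Thm. 1.1 (4), p.4 (PDF p.5)] locator: paper:arxiv-2411.03444 p0005.txt:L83–L85 -/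
theorem thm_1_1_gt_sharp (δ d k s : ℕ) (Δ : MvPolynomial (DegIdx (Fin k) d) ℂ)
    (hΔ : Δ.IsHomogeneous δ) (hs : affComplexity Δ ≤ s) (T : GTPattern k) :
    ∃ Δ' : MvPolynomial (DegIdx (Fin k) d) ℂ,
      Δ' ∈ gtSubspace (coordRep (Fin k) ℂ d) T ∧
      Δ - Δ' ∈ ⨆ T' ∈ {T' : GTPattern k | T' ≠ T}, gtSubspace (coordRep (Fin k) ℂ d) T' ∧
      Δ' ∈ Submodule.span ℂ (Set.range fun h : GL (Fin k) ℂ => coordRep (Fin k) ℂ d h Δ) ∧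
      affComplexity Δ' ≤ (δ * d + 1) ^ (k * k) * (s + 2) := by
  classical
  set ρ := coordRep (Fin k) ℂ d with hρ
  set M := Submodule.span ℂ (Set.range fun h : GL (Fin k) ℂ => ρ h Δ) with hM
  have hMstab : ∀ g, M ≤ M.comap (ρ g) := span_orbit_le_comap Δ
  obtain ⟨F, -, hFmem⟩ := exists_finset_forall_coordRep_mem_span Δ hΔ.totalDegree_le
  have hMF : M ≤ Submodule.span ℂ (F : Set (MvPolynomial (DegIdx (Fin k) d) ℂ)) :=
    Submodule.span_le.mpr (by rintro _ ⟨g, rfl⟩; exact hFmem g)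
  haveI : FiniteDimensional ℂ M := Submodule.finiteDimensional_of_le hMF
  obtain ⟨y, hyM, hyT, hxy⟩ := exists_gtComponent_mem (isRationalRep_coordRep d) M hMstab
    (self_mem_span_orbit Δ) T
  exact ⟨y, hyT, hxy, hyM, affComplexity_le_of_mem_span_orbit hΔ hs hyM⟩

/-- `(δd)^{2k³} ≤ (δd)^{2k⁴}` bookkeeping: `6 s k^{2k²} D^{2k³} ≤ 6 s k^{2k²} D^{2k⁴}` for `D ≥ 1`.
[cite: BergEtAl2024, Thm. 1.1 (4), p.4 (PDF p.5)] -/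
theorem gt_cost_le {D k s : ℕ} (hD : 1 ≤ D) :
    6 * s * k ^ (2 * k ^ 2) * D ^ (2 * k ^ 3) ≤ 6 * s * k ^ (2 * k ^ 2) * D ^ (2 * k ^ 4) := by
  refine Nat.mul_le_mul_left _ (Nat.pow_le_pow_right hD ?_)
  have : k ^ 3 ≤ k ^ 4 := by
    rcases Nat.eq_zero_or_pos k with rfl | hk
    · simp
    · exact Nat.pow_le_pow_right hk (by norm_num)
  omega

/-- **van den Berg–Dutta–Gesmundo–Ikenmeyer–Lysikov 2024, Theorem 1.1 (4) holds** (absolute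
constant `C = 6`): for a metapolynomial `Δ` of format `(δ, d, k)` with `cc(Δ) ≤ s` and every chain
`T`, the component of `Δ` in the `T`-isotypic (Gelfand–Tsetlin) component `V_T` (along the sum of
the other `V_{T'}`) has `cc ≤ 6 s k^{2k²} (δd)^{2k⁴}`. Route (a disclosed substitution for the
printed construction of `Y_T ∈ U(𝔤𝔩_k)` from Casimir operators, Cor. 5.8 / Thm. 5.10): the
`T`-component of `Δ` lies in the span `M` of the orbit `GL_k · Δ` — `M` is the direct sum of its
intersections with the `V_T` by refining, level by level, the isotypic decompositions of the
rational restrictions of `M` to `diag(GL_n, 1)` (`le_iSup_inf_gtSubspace`) — and every element of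
`M` (dimension `≤ (δd+1)^{k²}`, `exists_finset_forall_coordRep_mem_span`) is a combination of
`≤ (δd+1)^{k²}` translates of `Δ`, each of `cc ≤ s` (`affComplexity_le_of_mem_span_orbit`), whence
`cc ≤ (δd+1)^{k²}(s+2) ≤ 6 s k^{2k²} (δd)^{2k³} ≤ 6 s k^{2k²} (δd)^{2k⁴}` (`orbit_cost_le`; the
affine case `deg Δ ≤ 1` is free). Discharge of `BergEtAl2024.thm_1_1_gt` (typed above).
[cite: BergEtAl2024, Thm. 1.1 (4), p.4 (PDF p.5)] locator: paper:arxiv-2411.03444 p0005.txt:L83–L85 -/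
theorem thm_1_1_gt_holds : thm_1_1_gt := by
  refine ⟨6, fun δ d k s Δ hd hΔ hs T => ?_⟩
  obtain ⟨y, hyT, hxy, hyM, hcc⟩ := thm_1_1_gt_sharp δ d k s Δ hΔ hs T
  refine ⟨y, hyT, hxy, ?_⟩
  by_cases haff : Δ.totalDegree ≤ 1
  · rw [affComplexity_eq_zero_of_mem_span_of_totalDegree_le_one
      (totalDegree_le_one_of_mem_range_orbit haff) hyM]
    exact Nat.zero_le _
  · have hs1 : 1 ≤ s := by
      by_contra h0
      exact haff (totalDegree_le_one_of_affComplexity_eq_zero (by omega))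
    have hδ : 2 ≤ δ := by
      by_contra h
      exact haff (hΔ.totalDegree_le.trans (by omega))
    exact hcc.trans ((orbit_cost_le (by nlinarith) hs1).trans (gt_cost_le (by nlinarith)))

end Proof


end BergEtAl2024

end Literature.Barriers.ValiantsHypothesis
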